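import Summits.ResolutionOfSingularities.ResolutionOfSingularities.Theorems.FrobeniusLadderFRationalResolutionVertexChartMonoid
import HarnessLib

/-!
# Crux `FrobeniusLadder.FRationalResolution` (stmt-ResolutionOfSingularities-15317), line `redirect`,
# stub `stub_diagonalizableQuotientResolution` — **the three blow-up charts of the fixed point of a
# rank-two vertex chart, in the tree's `LogChart.blowupChartMonoid` currency** (point-blow-up recursion
# for the surface case over arbitrary fields, memo MEMO-15317-leafhand2-g6 §4, brick P4; continues
# `…VertexChartMonoid`)

For a vertex chart monoid `Q = L + {m·v + l·x : m ≥ 0, m + c·l ≥ 0}` (`c ≥ 1`, `(v, x)` independent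
modulo `L`, `y = c·v − x`) the non-units modulo `L` are generated AS A `Q`-MODULE by the three
monomials `s = {v, x, y}` (`exists_generator_sub_mem`: every `q ∈ Q ∖ L` is `h + q'` with `h ∈ s`,
`q' ∈ Q`). Consequently:

* `span_chi_three_eq` — for any monoid homomorphism `χ` on `Q` into a commutative ring, the ideal
  generated by `χ(Q ∖ L)` equals the ideal generated by `χ(v), χ(x), χ(y)`: the blow-up of the fixed
  point (whose maximal ideal is `𝔭 + (χ(Q ∖ L))`, `…ChartAlgebraFixedPoint`) is, up to the image of `𝔭`,
  the log blow-up along the monoid ideal generated by `s` — three charts;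
* `mem_blowupChartMonoid_three_iff` — the tree's chart monoid `LogChart.blowupChartMonoid Q s a`
  (`LogBlowupChart.lean`) at `a ∈ s` coincides with `⟨Q ∪ ((Q ∖ L) − a)⟩`; hence, by
  `…VertexChartMonoid`, **`mem_blowupChartMonoid_v_iff`** (the chart at `v` is the vertex chart with data
  `(v, x − v)` and parameter `c − 2`, for `c ≥ 2`) and **`mem_blowupChartMonoid_x_iff`** (the chart at
  `x` is `L ⊕ ℕx ⊕ ℕ(v − x)`; the chart at `y` follows by the symmetry `…VertexChartMonoid.vertex_symm`).

Honest label: combinatorics toward ONE leaf stub (no stub, crux or summit closed). No definitions, no named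
facts, no sorry. [cite: Kato1994, (10.1)] [cite: Niziol2006, §4]
-/

-- single-problem summit: the doubled namespace component is forced
set_option linter.dupNamespace false

open Literature.AlgebraicGeometry.Resolution Literature.AlgebraicGeometry.Resolution.LogChart
open Summit.ResolutionOfSingularities.ResolutionOfSingularities.Theorems.FRationalResolution.VertexChartMonoid

namespace Summit.ResolutionOfSingularities.ResolutionOfSingularities.Theorems.FRationalResolution.VertexChartBlowup

variable {n : ℕ} {L : Submodule ℤ (Fin n → ℤ)} {Q : AddSubmonoid (Fin n → ℤ)} {v x : Fin n → ℤ} {c : ℕ}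

/-! ### The three monomials generate the non-units as a `Q`-module -/

/-- **Every non-unit is a generator plus an element of `Q`**: for `q ∈ Q ∖ L` there is
`h ∈ {v, x, y}` with `q − h ∈ Q` (`c ≥ 1`). [cite: Kato1994, (10.1)] -/
theorem exists_generator_sub_mem (hc : 1 ≤ c)
    (hQ : ∀ w, w ∈ Q ↔ ∃ g ∈ L, ∃ m l : ℤ, 0 ≤ m ∧ 0 ≤ m + (c : ℤ) * l ∧ w = g + m • v + l • x)
    (hind : ∀ g ∈ L, ∀ m l : ℤ, g + m • v + l • x = 0 → m = 0 ∧ l = 0)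
    {q : Fin n → ℤ} (hq : q ∈ Q) (hqL : q ∉ L) :
    ∃ h : Fin n → ℤ, (h = v ∨ h = x ∨ h = (c : ℤ) • v - x) ∧ q - h ∈ Q := by
  obtain ⟨g, hg, m, l, hm, hml, rfl⟩ := (hQ q).1 hq
  rw [mem_L_iff hind hg] at hqL
  have hmem : ∀ m' l' : ℤ, 0 ≤ m' → 0 ≤ m' + (c : ℤ) * l' → g + m' • v + l' • x ∈ Q :=
    fun m' l' h1 h2 => (hQ _).2 ⟨g, hg, m', l', h1, h2, rfl⟩
  obtain ⟨f1, f2, f3⟩ := mul_le_facts c l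
  have f5 := (mul_le_facts' c l 1).2
  push_cast at f5
  rcases le_or_gt 1 l with hl | hl
  · -- `h = x`
    refine ⟨x, Or.inr (Or.inl rfl), ?_⟩
    have h1 : 0 ≤ m + (c : ℤ) * (l - 1) := by
      have := (mul_le_facts c (l - 1)).1 (by omega); omega
    have e : g + m • v + l • x - x = g + m • v + (l - 1) • x := by module
    rw [e]; exact hmem _ _ hm h1
  · rcases le_or_gt 0 l with hl0 | hl0
    · -- `l = 0`, `m ≥ 1`: `h = v`
      have hl00 : l = 0 := by omega
      refine ⟨v, Or.inl rfl, ?_⟩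
      have e : g + m • v + l • x - v = g + (m - 1) • v + l • x := by module
      rw [e]; exact hmem _ _ (by omega) (by rw [hl00, mul_zero, add_zero]; omega)
    · -- `l ≤ −1`: `h = y`
      refine ⟨(c : ℤ) • v - x, Or.inr (Or.inr rfl), ?_⟩
      have e : g + m • v + l • x - ((c : ℤ) • v - x) = g + (m - (c : ℤ)) • v + (l + 1) • x := by module
      rw [e]; exact hmem _ _ (by omega) (by rw [mul_add, mul_one]; omega)

/-- **The three monomials generate the ideal of non-units**: for a monoid homomorphism `χ` from `Q`
into a commutative ring, `(χ(q) : q ∈ Q ∖ L) = (χ(v), χ(x), χ(y))` as ideals (`c ≥ 1`).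
[cite: Kato1994, (10.1)] -/
theorem span_chi_three_eq {C : Type*} [CommRing C] (χ : Multiplicative Q →* C) (hc : 1 ≤ c)
    (hQ : ∀ w, w ∈ Q ↔ ∃ g ∈ L, ∃ m l : ℤ, 0 ≤ m ∧ 0 ≤ m + (c : ℤ) * l ∧ w = g + m • v + l • x)
    (hind : ∀ g ∈ L, ∀ m l : ℤ, g + m • v + l • x = 0 → m = 0 ∧ l = 0) :
    Ideal.span ((fun q : Q => χ (Multiplicative.ofAdd q)) '' {q : Q | (q : Fin n → ℤ) ∉ L}) =
      Ideal.span ((fun q : Q => χ (Multiplicative.ofAdd q)) ''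
        {q : Q | (q : Fin n → ℤ) = v ∨ (q : Fin n → ℤ) = x ∨ (q : Fin n → ℤ) = (c : ℤ) • v - x}) := by
  obtain ⟨⟨hvQ, hvL⟩, ⟨hxQ, hxL⟩, ⟨hyQ, hyL⟩⟩ := vertex_gens_mem hQ hind
  refine le_antisymm (Ideal.span_le.2 ?_) (Ideal.span_mono (Set.image_mono ?_))
  · rintro _ ⟨q, hq, rfl⟩
    obtain ⟨h, hh, hqh⟩ := exists_generator_sub_mem hc hQ hind q.2 hq
    have hhQ : h ∈ Q := by rcases hh with rfl | rfl | rfl <;> assumption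
    -- `χ(q) = χ(h) χ(q − h)`
    have e : χ (Multiplicative.ofAdd q) =
        χ (Multiplicative.ofAdd ⟨h, hhQ⟩) * χ (Multiplicative.ofAdd ⟨(q : Fin n → ℤ) - h, hqh⟩) := by
      rw [← map_mul, ← ofAdd_add]
      congr 1
      apply Multiplicative.toAdd.injective
      apply Subtype.ext
      change (q : Fin n → ℤ) = h + ((q : Fin n → ℤ) - h)
      abel
    change χ (Multiplicative.ofAdd q) ∈ _
    rw [e]
    exact Ideal.mul_mem_right _ _ (Ideal.subset_span ⟨⟨h, hhQ⟩, hh, rfl⟩)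
  · intro q hq
    change (q : Fin n → ℤ) ∉ L
    rcases hq with hq | hq | hq <;> rw [hq] <;> assumption

/-! ### The tree's blow-up chart monoids at the three monomials -/

/-- For `a ∈ s = {v, x, y}`, the tree's chart monoid `⟨Q ∪ (s − a)⟩` of the log blow-up along the
monoid ideal generated by `s` equals `⟨Q ∪ ((Q ∖ L) − a)⟩` (as `s` generates `Q ∖ L` over `Q`).
[cite: Niziol2006, §4 (proof of Prop. 4.2)] -/
theorem mem_blowupChartMonoid_three_iff (hc : 1 ≤ c)
    (hQ : ∀ w, w ∈ Q ↔ ∃ g ∈ L, ∃ m l : ℤ, 0 ≤ m ∧ 0 ≤ m + (c : ℤ) * l ∧ w = g + m • v + l • x)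
    (hind : ∀ g ∈ L, ∀ m l : ℤ, g + m • v + l • x = 0 → m = 0 ∧ l = 0)
    (a : Q) (ha : (a : Fin n → ℤ) = v ∨ (a : Fin n → ℤ) = x ∨ (a : Fin n → ℤ) = (c : ℤ) • v - x)
    (w : Fin n → ℤ) :
    w ∈ blowupChartMonoid Q
        {q : Q | (q : Fin n → ℤ) = v ∨ (q : Fin n → ℤ) = x ∨ (q : Fin n → ℤ) = (c : ℤ) • v - x} a ↔
      w ∈ AddSubmonoid.closure ((Q : Set (Fin n → ℤ)) ∪ (fun q => q - a) '' {q | q ∈ Q ∧ q ∉ L}) := by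
  obtain ⟨⟨hvQ, hvL⟩, ⟨hxQ, hxL⟩, ⟨hyQ, hyL⟩⟩ := vertex_gens_mem hQ hind
  have hsL : ∀ q : Q, ((q : Fin n → ℤ) = v ∨ (q : Fin n → ℤ) = x ∨ (q : Fin n → ℤ) = (c : ℤ) • v - x) →
      (q : Fin n → ℤ) ∉ L := by
    intro q hq
    rcases hq with hq | hq | hq <;> rw [hq] <;> assumption
  unfold blowupChartMonoid
  constructor
  · intro hw
    refine AddSubmonoid.closure_mono ?_ hw
    refine Set.union_subset_union_right _ ?_
    rintro _ ⟨q, hq, rfl⟩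
    exact ⟨q, ⟨q.2, hsL q hq⟩, rfl⟩
  · intro hw
    induction hw using AddSubmonoid.closure_induction with
    | mem z hz =>
      rcases hz with hz | ⟨q, ⟨hq, hqL⟩, rfl⟩
      · exact AddSubmonoid.subset_closure (Or.inl hz)
      · -- `q − a = (h − a) + (q − h)`
        obtain ⟨h, hh, hqh⟩ := exists_generator_sub_mem hc hQ hind hq hqL
        have hhQ : h ∈ Q := by rcases hh with rfl | rfl | rfl <;> assumption
        have e : q - (a : Fin n → ℤ) = ((⟨h, hhQ⟩ : Q) - (a : Fin n → ℤ)) + (q - h) := by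
          change q - (a : Fin n → ℤ) = (h - a) + (q - h); abel
        change q - (a : Fin n → ℤ) ∈ _
        rw [e]
        exact AddSubmonoid.add_mem _ (AddSubmonoid.subset_closure (Or.inr ⟨⟨h, hhQ⟩, hh, rfl⟩))
          (AddSubmonoid.subset_closure (Or.inl hqh))
    | zero => exact AddSubmonoid.zero_mem _
    | add y z _ _ hy hz => exact AddSubmonoid.add_mem _ hy hz

/-- **The chart at `v` is a vertex chart with parameter `c − 2`** (`c ≥ 2`): membership in the tree's
`LogChart.blowupChartMonoid Q {v, x, y} v` is `w = g + m v + l (x − v)`, `g ∈ L`, `m ≥ 0`,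
`m + (c − 2) l ≥ 0`. [cite: Kato1994, (10.1)] -/
theorem mem_blowupChartMonoid_v_iff (hc : 2 ≤ c)
    (hQ : ∀ w, w ∈ Q ↔ ∃ g ∈ L, ∃ m l : ℤ, 0 ≤ m ∧ 0 ≤ m + (c : ℤ) * l ∧ w = g + m • v + l • x)
    (hind : ∀ g ∈ L, ∀ m l : ℤ, g + m • v + l • x = 0 → m = 0 ∧ l = 0) (hv : v ∈ Q)
    (w : Fin n → ℤ) :
    w ∈ blowupChartMonoid Q
        {q : Q | (q : Fin n → ℤ) = v ∨ (q : Fin n → ℤ) = x ∨ (q : Fin n → ℤ) = (c : ℤ) • v - x} ⟨v, hv⟩ ↔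
      ∃ g ∈ L, ∃ m l : ℤ, 0 ≤ m ∧ 0 ≤ m + ((c - 2 : ℕ) : ℤ) * l ∧ w = g + m • v + l • (x - v) := by
  rw [mem_blowupChartMonoid_three_iff (by omega) hQ hind ⟨v, hv⟩ (Or.inl rfl)]
  exact mem_vertexBlowup_iff hc hQ hind w

/-- **The chart at `x` is free modulo `L`** (`c ≥ 2`): membership in `LogChart.blowupChartMonoid Q
{v, x, y} x` is `w = g + m x + l (v − x)`, `g ∈ L`, `m, l ≥ 0`. [cite: Kato1994, (10.1)] -/
theorem mem_blowupChartMonoid_x_iff (hc : 2 ≤ c)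
    (hQ : ∀ w, w ∈ Q ↔ ∃ g ∈ L, ∃ m l : ℤ, 0 ≤ m ∧ 0 ≤ m + (c : ℤ) * l ∧ w = g + m • v + l • x)
    (hind : ∀ g ∈ L, ∀ m l : ℤ, g + m • v + l • x = 0 → m = 0 ∧ l = 0) (hx : x ∈ Q)
    (w : Fin n → ℤ) :
    w ∈ blowupChartMonoid Q
        {q : Q | (q : Fin n → ℤ) = v ∨ (q : Fin n → ℤ) = x ∨ (q : Fin n → ℤ) = (c : ℤ) • v - x} ⟨x, hx⟩ ↔
      ∃ g ∈ L, ∃ m l : ℤ, 0 ≤ m ∧ 0 ≤ l ∧ w = g + m • x + l • (v - x) := by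
  rw [mem_blowupChartMonoid_three_iff (by omega) hQ hind ⟨x, hx⟩ (Or.inr (Or.inl rfl))]
  exact mem_endBlowup_iff hc hQ hind w

/-- The set `{v, x, y}` is the same for the symmetric data `(v, y)` (`c v − y = x`). [folklore] -/
theorem three_set_symm :
    {q : Q | (q : Fin n → ℤ) = v ∨ (q : Fin n → ℤ) = x ∨ (q : Fin n → ℤ) = (c : ℤ) • v - x} =
      {q : Q | (q : Fin n → ℤ) = v ∨ (q : Fin n → ℤ) = ((c : ℤ) • v - x) ∨
        (q : Fin n → ℤ) = (c : ℤ) • v - ((c : ℤ) • v - x)} := by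
  ext q
  simp only [Set.mem_setOf_eq, sub_sub_cancel]
  tauto

/-- **The chart at `y` is free modulo `L`** (`c ≥ 2`): membership in `LogChart.blowupChartMonoid Q
{v, x, y} y` is `w = g + m y + l (v − y)`, `g ∈ L`, `m, l ≥ 0` — the `x`-chart of the symmetric data
`(v, y)` (`…VertexChartMonoid.vertex_symm`). [cite: Kato1994, (10.1)] -/
theorem mem_blowupChartMonoid_y_iff (hc : 2 ≤ c)
    (hQ : ∀ w, w ∈ Q ↔ ∃ g ∈ L, ∃ m l : ℤ, 0 ≤ m ∧ 0 ≤ m + (c : ℤ) * l ∧ w = g + m • v + l • x)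
    (hind : ∀ g ∈ L, ∀ m l : ℤ, g + m • v + l • x = 0 → m = 0 ∧ l = 0) (hy : (c : ℤ) • v - x ∈ Q)
    (w : Fin n → ℤ) :
    w ∈ blowupChartMonoid Q
        {q : Q | (q : Fin n → ℤ) = v ∨ (q : Fin n → ℤ) = x ∨ (q : Fin n → ℤ) = (c : ℤ) • v - x}
        ⟨(c : ℤ) • v - x, hy⟩ ↔
      ∃ g ∈ L, ∃ m l : ℤ, 0 ≤ m ∧ 0 ≤ l ∧ w = g + m • ((c : ℤ) • v - x) + l • (v - ((c : ℤ) • v - x)) := by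
  obtain ⟨hQ', hind'⟩ := vertex_symm hQ hind
  rw [three_set_symm (Q := Q) (v := v) (x := x) (c := c)]
  exact mem_blowupChartMonoid_x_iff hc hQ' hind' hy w

end Summit.ResolutionOfSingularities.ResolutionOfSingularities.Theorems.FRationalResolution.VertexChartBlowup
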